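import Mathlib
import Summits.ResolutionOfSingularities.ResolutionOfSingularities.Theorems.WildQuotientsWildQuotientResolutionToricChartLemmas
import Summits.ResolutionOfSingularities.ResolutionOfSingularities.Theorems.WildQuotientsWildQuotientResolutionJordanFourConeVertexIdeals

/-!
# Toric chart certificates — coordinate-face ideals of a presented cone ring are prime

(crux stmt-ResolutionOfSingularities-15640 `WildQuotients.WildQuotientResolution`, line `Sketch`,
sector `|G| = p`; RUNG V5 brick B5/HP₀ of `L/w45c/CHAIN.md` v8.1 — the cone lane. For the brick's
FIRST blow-up (reduced singular axis of the `μ₄` cone, plan-1 RULING 11:31:32Z) the consumer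
(`BlowupExit.exists_isBlowup_regular_of_*`, `vanishingIdeal_eq_idealSheaf_of_isRadical`) needs the
centre to be a RADICAL ideal of the presented ring; this file proves the generic statement behind
`Third112.span_gens_isPrime` for every cone datum. [OURS · L1 W4.5c] — NOT a statement of any
manuscript; replaces the role of no printed item. Prover res-L1-w45c-stub-4 (gen 4).)

For a cone datum `D : ConeDatum d r` and a set `Z` of distinguished coordinates such that every
mixed generator involves a coordinate of `Z` (`hmix`) and the pure powers are positive (`hpw`), the
ideal of `A = ToricChart.Ring k P D` generated by the pure symbols `x_s^{pw s}`, `s ∈ Z`, and all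
mixed symbols — the ideal of the coordinate face `{x_s = 0, s ∈ Z}` of the cone — is the kernel of
`A → k[x]`, `x_s ↦ 0 (s ∈ Z)`, hence PRIME (`isPrime_faceIdeal`). Instances (`…Quarter1123Ideals`):
the singular axis `I_A` (`Z = {s,t,v}`) and the vertex `𝔪` (`Z = univ`) of `¼(1,1,2,3) × 𝔸^P`.

* `aeval_monomial_injective₂` — monomial substitutions `k[σ] → k[τ]` with injective exponent map
  are injective (two index types; cf. `MonomialMap.aeval_monomial_injective`).
-/

-- single-problem summit: the doubled namespace component `ResolutionOfSingularities` is forced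
set_option linter.dupNamespace false

noncomputable section

open MvPolynomial

namespace Summit.ResolutionOfSingularities.ResolutionOfSingularities.Theorems.WildQuotientResolution.ToricChart

variable {d r : ℕ}

/-- **A monomial substitution with injective exponent map is injective** (two index types): for
`M : σ → (τ →₀ ℕ)` with `e ↦ Σ_i e_i • M_i` injective, `aeval (x ↦ x^{M i}) : k[σ] → k[τ]` is
injective. [folklore] -/
theorem aeval_monomial_injective₂ {k : Type} [Field k] {σ τ : Type} (M : σ → (τ →₀ ℕ))
    (hL : Function.Injective (fun e : σ →₀ ℕ => e.sum fun i n => n • M i)) :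
    Function.Injective (MvPolynomial.aeval (R := k) (fun i => monomial (M i) (1 : k))) := by
  classical
  let L : (σ →₀ ℕ) →+ (τ →₀ ℕ) :=
    { toFun := fun e => e.sum fun i n => n • M i
      map_zero' := by simp
      map_add' := fun e e' => by
        rw [Finsupp.sum_add_index']
        · intro v; simp
        · intro v n n'; simp [add_smul] }
  have hL' : ∀ e : σ →₀ ℕ, L e = e.sum fun i n => n • M i := fun e => rfl
  have hLinj : Function.Injective L := hL
  let Φ : MvPolynomial σ k →ₐ[k] MvPolynomial τ k := AddMonoidAlgebra.mapDomainAlgHom k k L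
  have hΦ : ∀ g : MvPolynomial σ k, Φ g = AddMonoidAlgebra.mapDomain L g := fun g => by
    simp [Φ]
  have hΦinj : Function.Injective Φ := by
    intro f g h
    rw [hΦ, hΦ] at h
    exact AddMonoidAlgebra.mapDomain_injective hLinj h
  have key : MvPolynomial.aeval (R := k) (fun i => monomial (M i) (1 : k)) = Φ := by
    refine MvPolynomial.algHom_ext fun i => ?_
    rw [aeval_X, hΦ]
    have hX : (X i : MvPolynomial σ k) = AddMonoidAlgebra.single (Finsupp.single i 1) (1 : k) := rfl
    rw [hX, AddMonoidAlgebra.mapDomain_single, hL', Finsupp.sum_single_index (by simp)]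
    simp [MvPolynomial.single_eq_monomial]
  rw [key]
  exact hΦinj

section Face

variable (k : Type) [Field k] (P : Type) (D : ConeDatum d r) (Z : Finset (Fin d))

/-- The ideal of the coordinate face `{x_s = 0 : s ∈ Z}`: generated by the pure symbols of `Z` and
all mixed symbols. [OURS · L1 W4.5c] -/
def faceIdeal : Ideal (Ring k P D) :=
  Ideal.span (((fun s => wordElem k P D (pureWord s)) '' (Z : Set (Fin d))) ∪
    Set.range fun j : Fin r => wordElem k P D (mixedWord j))

/-- The substitution `x_s ↦ 0` for `s ∈ Z`, identity on the other variables. [folklore] -/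
def faceSubst : MvPolynomial (Fin d ⊕ P) k →ₐ[k] MvPolynomial (Fin d ⊕ P) k :=
  MvPolynomial.aeval (Sum.elim (fun s => if s ∈ Z then 0 else X (Sum.inl s)) fun p => X (Sum.inr p))

variable {k P D Z}

/-- The surviving symbols: pure symbols off `Z` and passengers. [folklore] -/
def Surv (P : Type) (Z : Finset (Fin d)) (r : ℕ) : Type :=
  {σ : (Fin d ⊕ P) ⊕ Fin r // ∃ v : Fin d ⊕ P, σ = Sum.inl v ∧ ∀ s, v = Sum.inl s → s ∉ Z}

/-- The complement of the surviving symbols: pure symbols of `Z` and mixed symbols. [folklore] -/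
theorem compl_range_surv :
    (Set.range (Subtype.val : Surv P Z r → (Fin d ⊕ P) ⊕ Fin r))ᶜ =
      ((fun s => Sum.inl (Sum.inl s)) '' (Z : Set (Fin d))) ∪ Set.range Sum.inr := by
  ext σ
  simp only [Set.mem_compl_iff, Set.mem_range, Subtype.exists, exists_prop, exists_eq_right,
    Set.mem_union, Set.mem_image, Finset.mem_coe, not_exists, not_and]
  constructor
  · intro h
    rcases σ with (s | p) | j
    · left
      refine ⟨s, ?_, rfl⟩
      by_contra hs
      exact h (Sum.inl s) rfl (fun s' hs' => by cases hs'; exact hs)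
    · exact absurd (fun s' hs' => by cases hs') (h (Sum.inr p) rfl)
    · right; exact ⟨j, rfl⟩
  · rintro (⟨s, hs, rfl⟩ | ⟨j, rfl⟩)
    · intro v hv hZ
      cases hv
      exact hZ s rfl hs
    · intro v hv; cases hv

/-- **The face ideal is prime** (for positive pure powers and mixed generators each involving a
coordinate of `Z`): it is the kernel of `A → k[x]`, `x_s ↦ 0` (`s ∈ Z`). [OURS · L1 W4.5c] -/
theorem isPrime_faceIdeal (hpw : ∀ s, 0 < D.pw s) (hmix : ∀ j : Fin r, ∃ i ∈ Z, D.mx j i ≠ 0) :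
    (faceIdeal k P D Z).IsPrime := by
  classical
  have hf : Function.Injective (Subtype.val : Surv P Z r → (Fin d ⊕ P) ⊕ Fin r) :=
    Subtype.val_injective
  let θ : MvPolynomial ((Fin d ⊕ P) ⊕ Fin r) k →ₐ[k] MvPolynomial (Fin d ⊕ P) k :=
    (faceSubst k P Z).comp (presentation k P D)
  have hθpure : ∀ s, θ (X (Sum.inl (Sum.inl s))) =
      (if s ∈ Z then 0 else X (Sum.inl s)) ^ D.pw s := by
    intro s
    simp [θ, faceSubst, presentation_X_inl_inl]
  have hθpass : ∀ p, θ (X (Sum.inl (Sum.inr p))) = X (Sum.inr p) := by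
    intro p
    simp [θ, faceSubst, presentation_X_inl_inr]
  have hθmixed : ∀ j, θ (X (Sum.inr j)) = 0 := by
    intro j
    obtain ⟨i, hiZ, hi⟩ := hmix j
    change faceSubst k P Z (presentation k P D (X (Sum.inr j))) = 0
    rw [presentation_X_inr, xmon, map_prod, Finset.prod_eq_zero (Finset.mem_univ i)]
    rw [map_pow]
    simp [faceSubst, hiZ, zero_pow hi]
  -- the kernel of θ contains the killed symbols
  have hsub : Ideal.span (X '' (Set.range (Subtype.val : Surv P Z r → (Fin d ⊕ P) ⊕ Fin r))ᶜ :
      Set (MvPolynomial ((Fin d ⊕ P) ⊕ Fin r) k)) ≤ RingHom.ker θ.toRingHom := by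
    rw [Ideal.span_le]
    rintro _ ⟨σ, hσ, rfl⟩
    rw [compl_range_surv] at hσ
    rcases hσ with ⟨s, hs, rfl⟩ | ⟨j, rfl⟩
    · change θ (X (Sum.inl (Sum.inl s))) = 0
      rw [hθpure, if_pos (Finset.mem_coe.mp hs), zero_pow (hpw s).ne']
    · exact hθmixed j
  -- the surviving symbols map injectively (a monomial map with injective exponents)
  let var : Surv P Z r → Fin d ⊕ P := fun σ => σ.2.choose
  have hvar : ∀ σ : Surv P Z r, σ.1 = Sum.inl (var σ) := fun σ => σ.2.choose_spec.1
  have hvarZ : ∀ (σ : Surv P Z r) (s : Fin d), var σ = Sum.inl s → s ∉ Z :=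
    fun σ => σ.2.choose_spec.2
  have var_inj : Function.Injective var := fun σ τ h =>
    Subtype.ext (by rw [hvar σ, hvar τ, h])
  let wt : Fin d ⊕ P → ℕ := Sum.elim (fun s => D.pw s) fun _ => 1
  have hwt : ∀ v, 0 < wt v := by
    rintro (s | p)
    · exact hpw s
    · exact Nat.one_pos
  let M : Surv P Z r → (Fin d ⊕ P →₀ ℕ) := fun σ => Finsupp.single (var σ) (wt (var σ))
  have hμval : ∀ σ : Surv P Z r, θ (X σ.1) = monomial (M σ) (1 : k) := by
    intro σ
    rw [hvar σ]
    change θ (X (Sum.inl (var σ))) = monomial (Finsupp.single (var σ) (wt (var σ))) 1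
    rcases hv : var σ with s | p
    · have hs : s ∉ Z := hvarZ σ s hv
      rw [hθpure, if_neg hs, X_pow_eq_monomial]
      rfl
    · rw [hθpass]
      change X (Sum.inr p) = monomial (Finsupp.single (Sum.inr p) 1) 1
      rfl
  have hM : Function.Injective (fun e : Surv P Z r →₀ ℕ => e.sum fun i n => n • M i) := by
    have hcoord : ∀ (e : Surv P Z r →₀ ℕ) (σ : Surv P Z r),
        (e.sum fun i n => n • M i) (var σ) = e σ * wt (var σ) := by
      intro e σ
      rw [Finsupp.sum_apply, Finsupp.sum, Finset.sum_eq_single σ]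
      · simp [M]
      · intro i _ hi
        simp [M, var_inj.ne hi]
      · intro hσ
        rw [Finsupp.mem_support_iff, not_not] at hσ
        simp [hσ]
    intro e e' h
    ext σ
    have h1 := congrArg (fun g : Fin d ⊕ P →₀ ℕ => g (var σ)) h
    simp only [hcoord] at h1
    exact Nat.eq_of_mul_eq_mul_right (hwt (var σ)) h1
  have hμ : Function.Injective
      ((θ : _ →ₐ[k] _).comp (rename (Subtype.val : Surv P Z r → (Fin d ⊕ P) ⊕ Fin r))) := by
    have heq : (θ : _ →ₐ[k] _).comp (rename (Subtype.val : Surv P Z r → (Fin d ⊕ P) ⊕ Fin r)) =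
        MvPolynomial.aeval (R := k) (fun i => monomial (M i) (1 : k)) := by
      refine MvPolynomial.algHom_ext fun σ => ?_
      rw [AlgHom.comp_apply, rename_X, hμval σ]
      exact (MvPolynomial.aeval_X (R := k) (fun i => monomial (M i) (1 : k)) σ).symm
    rw [heq]
    exact aeval_monomial_injective₂ M hM
  have hker : RingHom.ker θ.toRingHom =
      Ideal.span (X '' (Set.range (Subtype.val : Surv P Z r → (Fin d ⊕ P) ⊕ Fin r))ᶜ :
        Set (MvPolynomial ((Fin d ⊕ P) ⊕ Fin r) k)) := by
    refine le_antisymm (fun F hF => ?_) hsub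
    have hdiff := ConeVertex.sub_rename_killCompl_mem_span (R := k) hf F
    have h0 : killCompl hf F = 0 := by
      apply hμ
      rw [map_zero, AlgHom.comp_apply]
      have h1 : θ (F - rename Subtype.val (killCompl hf F)) = 0 := hsub hdiff
      rw [map_sub, sub_eq_zero] at h1
      rw [← h1]
      exact hF
    rwa [h0, map_zero, sub_zero] at hdiff
  have hle : RingHom.ker (presentation k P D).toRingHom ≤ RingHom.ker θ.toRingHom := by
    intro F hF
    rw [RingHom.mem_ker] at hF ⊢
    change faceSubst k P Z (presentation k P D F) = 0
    rw [show (presentation k P D).toRingHom F = presentation k P D F from rfl] at hF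
    rw [hF, map_zero]
  have h := ConeVertex.isPrime_span_image_mk_of_ker_eq (presentation k P D).toRingHom θ.toRingHom
    hle _ hker
  -- identify the generators
  have hgens : (Ideal.Quotient.mk (RingHom.ker (presentation k P D).toRingHom)) ''
      (X '' (Set.range (Subtype.val : Surv P Z r → (Fin d ⊕ P) ⊕ Fin r))ᶜ :
        Set (MvPolynomial ((Fin d ⊕ P) ⊕ Fin r) k)) =
      ((fun s => wordElem k P D (pureWord s)) '' (Z : Set (Fin d))) ∪
        Set.range fun j : Fin r => wordElem k P D (mixedWord j) := by
    rw [compl_range_surv, Set.image_union, Set.image_union, ← Set.image_comp, ← Set.image_comp,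
      ← Set.range_comp, ← Set.range_comp]
    congr 1
    · refine Set.image_congr' fun s => ?_
      change Ideal.Quotient.mk _ (X (Sum.inl (Sum.inl s))) = wordElem k P D (pureWord s)
      rw [wordElem, wordPoly_pureWord]
    · refine congrArg Set.range (funext fun j => ?_)
      change Ideal.Quotient.mk _ (X (Sum.inr j)) = wordElem k P D (mixedWord j)
      rw [wordElem, wordPoly_mixedWord]
  rw [hgens] at h
  exact h

/-- The face ideal is radical. [OURS · L1 W4.5c] -/
theorem isRadical_faceIdeal (hpw : ∀ s, 0 < D.pw s) (hmix : ∀ j : Fin r, ∃ i ∈ Z, D.mx j i ≠ 0) :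
    (faceIdeal k P D Z).IsRadical :=
  (isPrime_faceIdeal hpw hmix).isRadical

end Face

end Summit.ResolutionOfSingularities.ResolutionOfSingularities.Theorems.WildQuotientResolution.ToricChart

end
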